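import Summits.QuantumFields.YangMills.Theorems.BalabanLadderIRColdDoublingRecursionSC
import Summits.QuantumFields.YangMills.Theorems.BalabanLadderIRColdPurityBridgeRungs
import Literature.MathematicalPhysics.QuantumFieldTheory.CentralTwistFluxRemoval
import Literature.MathematicalPhysics.QuantumFieldTheory.TwistedPartitionFunctionRPBound
import Literature.Barriers.QuantumFields.MigdalKadanoffGroupBlindness
import HarnessLib

/-!
# Line `flux-purity-split` (ideator ym-ir-idea-10, lens «negation») on crux `IR` (stmt-QuantumFields-19354):
# the seed `E` cut along 't Hooft's electric flux — `E ⇐ ConfinedTemporalTwistSC ∧ VacuumSectorPuritySC`, with the two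
# abelian failures typed SEPARATELY

HONEST FRAMING.  Nothing here proves the Yang–Mills mass gap (Clay), `BalabanLadder.IR`, or `E`; R4 closes only the
conditional finite-𝕋⁴ rung `BalabanLadder.UV`.  This file posits ONE new object (`twistedColdZ`, the temporally
't-Hooft-twisted Wilson partition function of the 4:1 cold box), two obligation Props `F`, `V`, and PROVES the seams
`F → V → E`, `E → V` (so `V` is exactly the part of `E` that survives flux projection and `F` is the extra content);
the leaf is concluded BY NAME through line 10's `IR_of_bridge coldDoublingRecursionSC_holds`.  §4 (rev 1, critic P3 «located-A»):
per-`β` forms `ConfinedTemporalTwistAt` / `VacuumSectorPurityAt` with the per-`β` seam PROVED, V's strong-coupling rung PROVED by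
name from the tree's `coldExitSC_strongCoupling` (every compact `G`), F's strong-coupling rung (Münster's vortex free-energy area law
in cold-box form) TYPED-OPEN as `ConfinedTemporalTwistStrongCoupling` with a plan over the tree's PROVED polymer machinery.

THE CUT.  Write the cold-box thermal trace by electric-flux sectors, `Z(L³×t) = Σ_{e ∈ Ẑ(G)³} Z_e(t)` (transfer matrix on
the untwisted spatial torus; `e` = character of the centre `Z(G)` per direction).  't Hooft's temporal twist by central
`z = (z₀,z₁,z₂)` — multiply the holonomy of ONE stack of `(μ,3)`-plaquettes by `z_μ` — has `Z^{(z)}(t) = Σ_e e(z) Z_e(t)`, so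
averaging over a finite central subgroup `H` projects onto the fluxes annihilated by `H` (for `H = Z(G)³`: onto `e = 0`).
* `F = ConfinedTemporalTwistSC` («temporal twist is free in cold 4:1 boxes»): `|Z^{(z)}(L,t) − Z(L,t)| ≤ ε Z(L,t)` for
  `t ∈ {⌊L/4⌋, 2⌊L/4⌋}`, all central `z`, all `L ≥ L₁(β,ε)`, all `β ≥ β₁(ε)` — 't Hooft's HEAVY ELECTRIC FLUX
  (`Z_e/Z ≲ e^{−σ(β)·L·t} → 0`, confinement at each weak coupling) in partition-function currency; the currency of
  Tomboulis–Yaffe (rigorous twist/vortex free-energy inequalities) and of the numerical electric-flux free energies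
  (Kovács–Tomboulis, de Forcrand–von Smekal).
* `V = VacuumSectorPuritySC` («the flux-free sector of the cold box is pure»): for SOME finite central twist subgroup `s`
  (containing `1`, closed under `*`), the `s`-projected thermal state has purity defect `≤ ε` at some arbitrarily large `L` —
  E's gap-and-unique-vacuum content with the flux sectors quotiented out (`s = {1}` gives back `E`: `V ⇐ E` PROVED).
* Glue (PROVED, real inequalities only): `Z₂/Z₁² = (Z₂/A₂)·(A₂/A₁²)·(A₁/Z₁)²` with `A_i = |s|⁻¹ Σ_{z∈s} Z^{(z)}(t_i)`, so
  `F(ε') ∧ V(ε')` at one `(β, L)` give `δᶜ_β(L) ≤ 4ε'`.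

WHY (negation lens — where the abelian witness bites, twice and differently).  At `G = U(1)` (centre = everything, twists
`z = e^{iα}`): `F` is FALSE at weak coupling because electric flux is LIGHT — Gauss/theta duality gives
`Z^{(α)}/Z → ϑ-ratio ≈ exp(−2βα²·L/(4t))`, i.e. `≈ e^{−2βα²} ↛ 1` at `t = L/4` (Coulomb phase: flux energy `e²/(2βL)` per
unit time, NO string tension); `V` is FALSE for every finite `s` because the PHOTON gas sits in the flux-free sector:
`A₂/A₁² ≈ e^{−20}` (exact lattice Gaussian photon, critic ym-ir-crit-3 `i10_1_lite.py`: exponent −22.7 at L = 32, −19.9 at L = 64;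
the thin-slab Stefan–Boltzmann limit is −(π²/45)(L/t₁)³(2 − 1/8) = −26.3), β-independent.  So a proof
of `F` must use CONFINEMENT OF ELECTRIC FLUX (absent for U(1)₄ at weak coupling — Guth/FS), and a proof of `V` must use the
MASS OF THE NEUTRAL SECTOR (absent for U(1)₄ — the photon); neither alone is `E`, and the group-blind barrier is met by
each conjunct at a DIFFERENT physical mechanism — which is the point of the cut: `F` is a pure confinement statement with an
existing rigorous technology (RP + Migdal–Kadanoff bounds on twisted ratios: Tomboulis–Yaffe 1985; Tomboulis 2007 claimed all β,
gap located by Ito–Seiler 2007), `V` is the spectral statement in the sector where centre symmetry cannot help or hurt.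
At `SO(3)` (trivial centre) `F` is trivially true (`z = 1` only, `twistedColdZ_one`) and `V = E[SO(3)]` is false ('t Hooft magnetic flux vacua, line `lightmode-exposure`):
the π₁ load sits entirely in `V`.

Refs: 't Hooft, Nucl. Phys. B153 (1979) 141; Tomboulis–Yaffe, Commun. Math. Phys. 100 (1985) 313; Tomboulis, arXiv:0707.2179;
Ito–Seiler, arXiv:0711.4930; Kovács–Tomboulis, Phys. Rev. Lett. 85 (2000) 704 (hep-lat/0002004); de Forcrand–von Smekal,
Phys. Rev. D66 (2002) 011504 (hep-lat/0107018); Greensite, LNP 821 (2011) §4.4; Guth, Phys. Rev. D21 (1980) 2291;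
Fröhlich–Spencer, Commun. Math. Phys. 83 (1982) 411; Münster, Nucl. Phys. B180 (1981) 23 (strong-coupling vortex free energy).
-/

set_option autoImplicit false

noncomputable section

open Filter Topology MeasureTheory
open scoped BigOperators
open Literature.MathematicalPhysics.QuantumFieldTheory Literature.MathematicalPhysics.QuantumLattice
open Summit.QuantumFields.YangMills.Cruxes.IR.ColdPurityBridge
  (coldDefect ColdExitSC ColdDoublingRecursionSC IR_of_bridge coldExitSC_strongCoupling)
open Summit.QuantumFields.YangMills.Cruxes.IR.ColdPressurePincer (AFToColdPressure IRnsc)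
open Summit.QuantumFields.YangMills.Cruxes.IR.AspectBootstrap (coldDoublingRecursionSC_holds)
open Literature.MathematicalPhysics.QuantumFieldTheory.Balaban1983to89.Missing (strongCouplingRadius)

namespace Summit.QuantumFields.YangMills.Cruxes.IR.FluxPuritySplit

/-! ## §0 The new object: the temporally twisted Wilson partition function of the box `L³ × t` -/

section Defs

variable {G : Type} [Group G]

/-- The four coordinates of a site of the `Fin`-torus, as naturals. -/
def siteCoord {n₀ n₁ n₂ n₃ : ℕ} (x : FinTorusSite n₀ n₁ n₂ n₃) : Fin 4 → ℕ :=
  ![(x.1 : ℕ), (x.2.1 : ℕ), (x.2.2.1 : ℕ), (x.2.2.2 : ℕ)]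

/-- **'t Hooft's temporal twist insertion.**  The plaquette at site `x` with orientation `(μ, ν)` is multiplied by `z μ`
iff it is a temporal plaquette (`ν = 3`, the short direction of the cold box) of the ONE stack `x₃ = 0`, `x_μ = 0`
(all values of the two remaining coordinates); every other plaquette is untouched.  For central `z μ` the position of the
stack is immaterial (change of variables). ['t Hooft 1979, §2; Greensite 2011, (4.29)] -/
def twistFactor (z : Fin 4 → G) {n₀ n₁ n₂ n₃ : ℕ} (x : FinTorusSite n₀ n₁ n₂ n₃) (μ ν : Fin 4) : G :=
  if ν = 3 ∧ siteCoord x 3 = 0 ∧ siteCoord x μ = 0 then z μ else 1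

@[simp] theorem twistFactor_one {n₀ n₁ n₂ n₃ : ℕ} (x : FinTorusSite n₀ n₁ n₂ n₃) (μ ν : Fin 4) :
    twistFactor (1 : Fin 4 → G) x μ ν = 1 := by
  unfold twistFactor
  split <;> simp

variable {n : ℕ} (ρ : G →* Matrix (Fin n) (Fin n) ℂ) [TopologicalSpace G] [IsTopologicalGroup G] [CompactSpace G]
  [MeasurableSpace G] [BorelSpace G]

/-- **The temporally twisted Wilson partition function of the cold box `L × L × L × t`**, twist `z = (z 0, z 1, z 2)` in the
three temporal planes (`z 3` is never read): VERBATIM `wilsonFinTorusPartition ρ β L L L t` with the plaquette holonomy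
`U_{x,μν}` replaced by `twistFactor z x μ ν · U_{x,μν}`.  `twistedColdZ ρ β 1 L t = wilsonFinTorusPartition ρ β L L L t`
(`twistedColdZ_one`).  Transfer-matrix reading (central `z`): `Z^{(z)}(t) = Σ_e e(z) Z_e(t)` over electric-flux sectors.
['t Hooft 1979, (2.14)–(2.20)] -/
def twistedColdZ (β : ℝ) (z : Fin 4 → G) (L t : ℕ) : ℝ :=
  ∫ U, Real.exp (-β * ∑ x : FinTorusSite L L L t, ∑ q : {q : Fin 4 × Fin 4 // q.1 < q.2},
      ((n : ℝ) - (ρ (twistFactor z x q.1.1 q.1.2 * finTorusPlaquette U x q.1.1 q.1.2)).trace.re))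
    ∂(Measure.pi fun _ : FinTorusSite L L L t × Fin 4 => haarProbability G)

/-- No twist is the Wilson partition function. -/
theorem twistedColdZ_one (β : ℝ) (L t : ℕ) :
    twistedColdZ ρ β (1 : Fin 4 → G) L t = wilsonFinTorusPartition ρ β L L L t := by
  simp [twistedColdZ, wilsonFinTorusPartition]

end Defs

/-! ## §1 The two obligation Props (OPEN; nothing claimed) -/

/-- **F — confined temporal twist in cold 4:1 boxes (simply-connected simple `G`).**  For every `ε > 0`, beyond `β₁(ε)`,
for all `L ≥ L₁(β, ε)`, every central temporal twist changes the partition function of `L³ × t`, `t ∈ {⌊L/4⌋, 2⌊L/4⌋}`, by at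
most the fraction `ε`: 't Hooft's heavy electric flux `Z_e/Z → 0` at each weak coupling.  FALSE for `U(1)₄` at weak coupling
(light flux: `Z^{(α)}/Z ≈ e^{−2βα²}`); trivially true for centre-free `G`.  Why it might fail for `SU(N)`: only if electric flux
deconfines in cold boxes at some weak coupling (a bulk deconfinement transition) — physics says no; rigorously open beyond
strong coupling (OS78) — Tomboulis 2007's all-β claim has a located gap (Ito–Seiler). [tHooft1979] [TomboulisYaffe1985] -/
def ConfinedTemporalTwistSC : Prop :=
  ∀ (G : Type) [Group G] [TopologicalSpace G] [IsTopologicalGroup G] [CompactSpace G],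
    IsCompactSimpleLieGroup G → SimplyConnectedSpace G →
    letI : MeasurableSpace G := borel G
    haveI : BorelSpace G := ⟨rfl⟩
    ∀ r : LatticeRep G, ∀ ε : ℝ, 0 < ε → ∃ β₁ : ℝ, ∀ β : ℝ, β₁ ≤ β → ∃ L₁ : ℕ, ∀ L : ℕ, L₁ ≤ L →
      ∀ z : Fin 4 → G, (∀ μ, z μ ∈ Subgroup.center G) → ∀ t : ℕ, (t = L / 4 ∨ t = 2 * (L / 4)) →
        |twistedColdZ r.ρ β z L t - wilsonFinTorusPartition r.ρ β L L L t| ≤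
          ε * wilsonFinTorusPartition r.ρ β L L L t

/-- **V — purity of a flux-projected cold box (simply-connected simple `G`).**  For every `ε > 0`, beyond `β₁(ε)`, at SOME
arbitrarily large `L`, for SOME finite set `s` of central temporal twists containing `1` and closed under `*` (a finite central
subgroup; `s = {1}` allowed), the `s`-averaged thermal state `A_t = |s|⁻¹ Σ_{z∈s} Z^{(z)}(L³×t)` (= the trace over the flux
sectors annihilated by `s`) has period-doubling purity defect `1 − A_{2⌊L/4⌋}/A_{⌊L/4⌋}² ≤ ε`.  `E → V` (PROVED, `s = {1}`).
FALSE for `U(1)₄` for EVERY finite `s` (the photon gas lives in the flux-free sector: `A₂/A₁² ≈ e^{−20}`); FALSE for `SO(3)`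
(`s = {1}` forced; light magnetic-flux vacua).  Why it might fail for `SU(N)`: it is the gap + unique-vacuum content of `E`
in the `e = 0` sector — summit-adjacent; the cut only removes the flux bookkeeping. [tHooft1979] [Luscher1977] -/
def VacuumSectorPuritySC : Prop :=
  ∀ (G : Type) [Group G] [TopologicalSpace G] [IsTopologicalGroup G] [CompactSpace G],
    IsCompactSimpleLieGroup G → SimplyConnectedSpace G →
    letI : MeasurableSpace G := borel G
    haveI : BorelSpace G := ⟨rfl⟩
    ∀ r : LatticeRep G, ∀ ε : ℝ, 0 < ε → ∃ β₁ : ℝ, ∀ β : ℝ, β₁ ≤ β → ∀ L₀ : ℕ, ∃ L : ℕ, L₀ ≤ L ∧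
      ∃ s : Finset (Fin 4 → G), (1 : Fin 4 → G) ∈ s ∧ (∀ z ∈ s, ∀ w ∈ s, z * w ∈ s) ∧
        (∀ z ∈ s, ∀ μ, z μ ∈ Subgroup.center G) ∧
        1 - (s.card : ℝ) * (∑ z ∈ s, twistedColdZ r.ρ β z L (2 * (L / 4))) /
              (∑ z ∈ s, twistedColdZ r.ρ β z L (L / 4)) ^ 2 ≤ ε

/-! ## §2 The seams (PROVED): `F → V → E` by real inequalities, and `E → V` -/

/-- **The arithmetic of the cut.**  If `S₁, S₂` are within the fraction `ε` of `n Z₁, n Z₂` (`F`, summed over the `n = |s|`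
twists) and the projected defect `1 − n S₂/S₁²` is `≤ ε` (`V`), then `1 − Z₂/Z₁² ≤ 4ε` (`ε ≤ 1/8`). -/
theorem defect_le_of_flux_vac (Z₁ Z₂ S₁ S₂ n ε : ℝ) (hn : 1 ≤ n) (hZ₁ : 0 < Z₁) (hZ₂ : 0 < Z₂)
    (hε0 : 0 ≤ ε) (hε : ε ≤ 1 / 8)
    (ha : |S₁ - n * Z₁| ≤ ε * (n * Z₁)) (hb : |S₂ - n * Z₂| ≤ ε * (n * Z₂))
    (hc : 1 - n * S₂ / S₁ ^ 2 ≤ ε) : 1 - Z₂ / Z₁ ^ 2 ≤ 4 * ε := by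
  have hn0 : 0 < n := lt_of_lt_of_le one_pos hn
  have hnZ₁ : 0 < n * Z₁ := mul_pos hn0 hZ₁
  have hnZ₂ : 0 < n * Z₂ := mul_pos hn0 hZ₂
  have hS₁ : (1 - ε) * (n * Z₁) ≤ S₁ := by
    have := (abs_sub_le_iff.1 ha).2
    nlinarith
  have h1ε : 0 < 1 - ε := by linarith
  have hS₁pos : 0 < S₁ := lt_of_lt_of_le (mul_pos h1ε hnZ₁) hS₁
  have hS₂ : S₂ ≤ (1 + ε) * (n * Z₂) := by
    have := (abs_sub_le_iff.1 hb).1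
    nlinarith
  have hS₁sq : 0 < S₁ ^ 2 := by positivity
  have hc' : (1 - ε) * S₁ ^ 2 ≤ n * S₂ := by
    have h1 : 1 - ε ≤ n * S₂ / S₁ ^ 2 := by linarith
    exact (le_div_iff₀ hS₁sq).1 h1
  -- lower bound on `S₁²`
  have h3 : (1 - ε) ^ 2 * (n * Z₁) ^ 2 ≤ S₁ ^ 2 := by
    have h0 : 0 ≤ (1 - ε) * (n * Z₁) := le_of_lt (mul_pos h1ε hnZ₁)
    have := pow_le_pow_left₀ h0 hS₁ 2
    simpa [mul_pow] using this
  -- chain: `(1-ε)³ n² Z₁² ≤ (1-ε) S₁² ≤ n S₂ ≤ (1+ε) n² Z₂`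
  have h4 : (1 - ε) ^ 3 * (n * Z₁) ^ 2 ≤ n * S₂ := by
    have := mul_le_mul_of_nonneg_left h3 (le_of_lt h1ε)
    nlinarith
  have h5 : n * S₂ ≤ (1 + ε) * n * (n * Z₂) := by nlinarith
  have h6 : (1 - ε) ^ 3 * Z₁ ^ 2 ≤ (1 + ε) * Z₂ := by
    have h45 : (1 - ε) ^ 3 * (n * Z₁) ^ 2 ≤ (1 + ε) * n * (n * Z₂) := le_trans h4 h5
    have hn2 : 0 < n ^ 2 := by positivity
    have : (1 - ε) ^ 3 * Z₁ ^ 2 * n ^ 2 ≤ (1 + ε) * Z₂ * n ^ 2 := by nlinarith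
    exact le_of_mul_le_mul_right this hn2
  -- `(1-4ε)(1+ε) ≤ (1-ε)³` on `[0, 1/8]`
  have h7 : (1 - 4 * ε) * (1 + ε) ≤ (1 - ε) ^ 3 := by
    have h : 0 ≤ ε ^ 2 * (7 - ε) := mul_nonneg (sq_nonneg ε) (by linarith)
    nlinarith [h]
  have hZ₁sq : 0 < Z₁ ^ 2 := by positivity
  have h8 : (1 - 4 * ε) * Z₁ ^ 2 ≤ Z₂ := by
    have h1e : 0 < 1 + ε := by linarith
    have : (1 - 4 * ε) * (1 + ε) * Z₁ ^ 2 ≤ (1 + ε) * Z₂ := by nlinarith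
    nlinarith
  have h9 : 1 - 4 * ε ≤ Z₂ / Z₁ ^ 2 := by
    rw [le_div_iff₀ hZ₁sq]
    exact h8
  linarith

section Seams

variable {G : Type} [Group G] [TopologicalSpace G] [IsTopologicalGroup G] [CompactSpace G]
  [MeasurableSpace G] [BorelSpace G]

/-- **`F ∧ V ⇒ E` at one `(G, r, β, L)`** — the bookkeeping instance of `defect_le_of_flux_vac` over a twist set `s`. -/
theorem coldDefect_le_of_flux_vac (r : LatticeRep G) (β : ℝ) (L : ℕ) {ε : ℝ} (hε0 : 0 ≤ ε) (hε : ε ≤ 1 / 8)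
    (s : Finset (Fin 4 → G)) (h1 : (1 : Fin 4 → G) ∈ s)
    (hF : ∀ z ∈ s, ∀ t : ℕ, (t = L / 4 ∨ t = 2 * (L / 4)) →
      |twistedColdZ r.ρ β z L t - wilsonFinTorusPartition r.ρ β L L L t| ≤
        ε * wilsonFinTorusPartition r.ρ β L L L t)
    (hV : 1 - (s.card : ℝ) * (∑ z ∈ s, twistedColdZ r.ρ β z L (2 * (L / 4))) /
              (∑ z ∈ s, twistedColdZ r.ρ β z L (L / 4)) ^ 2 ≤ ε) :
    coldDefect r.ρ β L ≤ 4 * ε := by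
  haveI : SecondCountableTopology G :=
    (r.continuous.isClosedEmbedding r.injective).isEmbedding.secondCountableTopology
  set Z₁ := wilsonFinTorusPartition r.ρ β L L L (L / 4) with hZ₁def
  set Z₂ := wilsonFinTorusPartition r.ρ β L L L (2 * (L / 4)) with hZ₂def
  have hZ₁ : 0 < Z₁ := wilsonFinTorusPartition_pos r.continuous β L L L (L / 4)
  have hZ₂ : 0 < Z₂ := wilsonFinTorusPartition_pos r.continuous β L L L (2 * (L / 4))
  have hn : (1 : ℝ) ≤ (s.card : ℝ) := by
    exact_mod_cast Finset.card_pos.2 ⟨1, h1⟩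
  -- sum the twist bounds over `s`
  have hsum : ∀ t : ℕ, (t = L / 4 ∨ t = 2 * (L / 4)) →
      |∑ z ∈ s, twistedColdZ r.ρ β z L t - (s.card : ℝ) * wilsonFinTorusPartition r.ρ β L L L t| ≤
        ε * ((s.card : ℝ) * wilsonFinTorusPartition r.ρ β L L L t) := by
    intro t ht
    have hrw : ∑ z ∈ s, twistedColdZ r.ρ β z L t - (s.card : ℝ) * wilsonFinTorusPartition r.ρ β L L L t =
        ∑ z ∈ s, (twistedColdZ r.ρ β z L t - wilsonFinTorusPartition r.ρ β L L L t) := by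
      rw [Finset.sum_sub_distrib, Finset.sum_const, nsmul_eq_mul]
    rw [hrw]
    calc |∑ z ∈ s, (twistedColdZ r.ρ β z L t - wilsonFinTorusPartition r.ρ β L L L t)|
        ≤ ∑ z ∈ s, |twistedColdZ r.ρ β z L t - wilsonFinTorusPartition r.ρ β L L L t| :=
          Finset.abs_sum_le_sum_abs _ _
      _ ≤ ∑ z ∈ s, ε * wilsonFinTorusPartition r.ρ β L L L t := Finset.sum_le_sum fun z hz => hF z hz t ht
      _ = ε * ((s.card : ℝ) * wilsonFinTorusPartition r.ρ β L L L t) := by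
          rw [Finset.sum_const, nsmul_eq_mul]; ring
  have ha := hsum (L / 4) (Or.inl rfl)
  have hb := hsum (2 * (L / 4)) (Or.inr rfl)
  show 1 - Z₂ / Z₁ ^ 2 ≤ 4 * ε
  exact defect_le_of_flux_vac Z₁ Z₂ _ _ (s.card : ℝ) ε hn hZ₁ hZ₂ hε0 hε ha hb hV

end Seams

/-- **The seam `F → V → E` (PROVED).**  Quantifier bookkeeping over `coldDefect_le_of_flux_vac` at `ε' = min ε 1 / 8`. -/
theorem coldExitSC_of_split (hF : ConfinedTemporalTwistSC) (hV : VacuumSectorPuritySC) : ColdExitSC := by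
  intro G _ _ _ _ hG hsc
  letI : MeasurableSpace G := borel G
  haveI : BorelSpace G := ⟨rfl⟩
  intro r ε hε
  set ε' : ℝ := min ε 1 / 8 with hε'def
  have hε'0 : 0 < ε' := by
    rw [hε'def]; have := lt_min hε one_pos; positivity
  have hε'1 : ε' ≤ 1 / 8 := by
    rw [hε'def]; have := min_le_right ε 1; linarith
  have hε'ε : 4 * ε' ≤ ε := by
    rw [hε'def]; have := min_le_left ε 1; linarith
  obtain ⟨βF, hβF⟩ := hF G hG hsc r ε' hε'0
  obtain ⟨βV, hβV⟩ := hV G hG hsc r ε' hε'0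
  refine ⟨max βF βV, fun β hβ L₀ => ?_⟩
  obtain ⟨L₁, hL₁⟩ := hβF β (le_trans (le_max_left _ _) hβ)
  obtain ⟨L, hL, s, h1, -, hcen, hVL⟩ := hβV β (le_trans (le_max_right _ _) hβ) (max L₀ L₁)
  refine ⟨L, le_trans (le_max_left _ _) hL, ?_⟩
  have hFL : ∀ z ∈ s, ∀ t : ℕ, (t = L / 4 ∨ t = 2 * (L / 4)) →
      |twistedColdZ r.ρ β z L t - wilsonFinTorusPartition r.ρ β L L L t| ≤
        ε' * wilsonFinTorusPartition r.ρ β L L L t :=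
    fun z hz t ht => hL₁ L (le_trans (le_max_right _ _) hL) z (hcen z hz) t ht
  exact le_trans (coldDefect_le_of_flux_vac r β L hε'0.le hε'1 s h1 hFL hVL) hε'ε

/-- **`E → V` (PROVED, `s = {1}`)**: flux-projected purity is a CONSEQUENCE of `E`; the cut's extra content is `F` alone. -/
theorem vacuumSectorPurity_of_coldExit (hE : ColdExitSC) : VacuumSectorPuritySC := by
  intro G _ _ _ _ hG hsc
  letI : MeasurableSpace G := borel G
  haveI : BorelSpace G := ⟨rfl⟩
  intro r ε hε
  obtain ⟨β₁, hβ₁⟩ := hE G hG hsc r ε hε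
  refine ⟨β₁, fun β hβ L₀ => ?_⟩
  obtain ⟨L, hL, hδ⟩ := hβ₁ β hβ L₀
  refine ⟨L, hL, {(1 : Fin 4 → G)}, Finset.mem_singleton_self _, ?_, ?_, ?_⟩
  · intro z hz w hw
    rw [Finset.mem_singleton] at hz hw ⊢
    rw [hz, hw, one_mul]
  · intro z hz μ
    rw [Finset.mem_singleton] at hz
    rw [hz, Pi.one_apply]
    exact Subgroup.one_mem _
  · simpa [twistedColdZ_one, coldDefect] using hδ

/-! ## §4 Rungs (critic P3 «located-A»): per-`β` forms, the strong-coupling window, and where each conjunct's rung lives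

Per `(G, r, β)` — EVERY compact `G`, no simplicity, no `π₁` (the rung regime is group-blind, like E's `coldExitSC_strongCoupling`):
* `VacuumSectorPurityAt r β` holds on `0 ≤ β ≤ strongCouplingRadius r.ρ` — PROVED BY NAME from the tree rung
  `ColdPurityBridge.coldExitSC_strongCoupling` (`s = {1}`); honest: V's rung IS E's rung (V ⇐ E pointwise).
* `ConfinedTemporalTwistAt r β` on the same window = 't Hooft twist-insensitivity at strong coupling = Münster's vortex
  free-energy AREA LAW (`|log Z^{(z)} − log Z| ≤ 3L² (cβ)^{L·t}`: a connected polymer sees the twist class only if it wraps the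
  twisted 2-torus, ≥ `L·t` plaquettes, because on a contractible polymer a central twist is a coboundary = a change of variables)
  — TYPED-OPEN as `ConfinedTemporalTwistStrongCoupling` (no sorry); plan: the tree's PROVED polymer machinery
  `Balaban1983to89.InfiniteVolumeSufficientXV` (`PlaqSystem`, `Regular`, `logDensity`, `truncatedWeight` bounds) with the twisted
  cost as a `PlaqSystem` and the coboundary lemma for non-wrapping clusters.  TRUE for `U(1)` too (strong-coupling `U(1)` confines):
  the abelian kill of `F` is a WEAK-coupling phenomenon, as the lens requires. [Munster1981: G. Münster, Nucl. Phys. B180 (1981) 23]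
* the per-`β` seam `ConfinedTemporalTwistAt r β → VacuumSectorPurityAt r β → ∀ ε>0 ∀ L₀ ∃ L ≥ L₀, δᶜ_β(L) ≤ 4·min ε 1/8…` (PROVED). -/

section Rungs

variable {G : Type} [Group G] [TopologicalSpace G] [IsTopologicalGroup G] [CompactSpace G]
  [MeasurableSpace G] [BorelSpace G]

/-- `F` at one `(G, r, β)`: every central temporal twist is `ε`-invisible in `Z(L³ × t)`, `t ∈ {⌊L/4⌋, 2⌊L/4⌋}`, for all large `L`. -/
def ConfinedTemporalTwistAt (r : LatticeRep G) (β : ℝ) : Prop :=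
  ∀ ε : ℝ, 0 < ε → ∃ L₁ : ℕ, ∀ L : ℕ, L₁ ≤ L →
    ∀ z : Fin 4 → G, (∀ μ, z μ ∈ Subgroup.center G) → ∀ t : ℕ, (t = L / 4 ∨ t = 2 * (L / 4)) →
      |twistedColdZ r.ρ β z L t - wilsonFinTorusPartition r.ρ β L L L t| ≤ ε * wilsonFinTorusPartition r.ρ β L L L t

/-- `V` at one `(G, r, β)`: some flux-projected cold box beyond every `L₀` is `ε`-pure. -/
def VacuumSectorPurityAt (r : LatticeRep G) (β : ℝ) : Prop :=
  ∀ ε : ℝ, 0 < ε → ∀ L₀ : ℕ, ∃ L : ℕ, L₀ ≤ L ∧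
    ∃ s : Finset (Fin 4 → G), (1 : Fin 4 → G) ∈ s ∧ (∀ z ∈ s, ∀ w ∈ s, z * w ∈ s) ∧
      (∀ z ∈ s, ∀ μ, z μ ∈ Subgroup.center G) ∧
      1 - (s.card : ℝ) * (∑ z ∈ s, twistedColdZ r.ρ β z L (2 * (L / 4))) /
            (∑ z ∈ s, twistedColdZ r.ρ β z L (L / 4)) ^ 2 ≤ ε

/-- `V` from the per-`β` body of `E` (`s = {1}`), every compact `G`. -/
theorem vacuumSectorPurityAt_of_coldExit (r : LatticeRep G) (β : ℝ)
    (hE : ∀ ε : ℝ, 0 < ε → ∀ L₀ : ℕ, ∃ L : ℕ, L₀ ≤ L ∧ coldDefect r.ρ β L ≤ ε) :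
    VacuumSectorPurityAt r β := by
  intro ε hε L₀
  obtain ⟨L, hL, hδ⟩ := hE ε hε L₀
  refine ⟨L, hL, {(1 : Fin 4 → G)}, Finset.mem_singleton_self _, ?_, ?_, ?_⟩
  · intro z hz w hw
    rw [Finset.mem_singleton] at hz hw ⊢
    rw [hz, hw, one_mul]
  · intro z hz μ
    rw [Finset.mem_singleton] at hz
    rw [hz, Pi.one_apply]
    exact Subgroup.one_mem _
  · simpa [twistedColdZ_one, coldDefect] using hδ

/-- **RUNG for V (PROVED, by name): flux-projected purity on the strong-coupling window `0 ≤ β ≤ strongCouplingRadius r.ρ`,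
EVERY compact `G`** — from the tree rung `ColdPurityBridge.coldExitSC_strongCoupling`.  Honest: this is E's rung re-read. -/
theorem vacuumSectorPurityAt_strongCoupling (r : LatticeRep G) {β : ℝ} (hβ0 : 0 ≤ β)
    (hβ : β ≤ strongCouplingRadius r.ρ) : VacuumSectorPurityAt r β :=
  vacuumSectorPurityAt_of_coldExit r β fun _ε hε L₀ => coldExitSC_strongCoupling r hβ0 hβ hε L₀

/-- **The per-`β` seam (PROVED)**: `F ∧ V` at `(G, r, β)` ⇒ cold exit at `β` (every compact `G`). -/
theorem coldExitAt_of_splitAt (r : LatticeRep G) (β : ℝ) (hF : ConfinedTemporalTwistAt r β)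
    (hV : VacuumSectorPurityAt r β) :
    ∀ ε : ℝ, 0 < ε → ∀ L₀ : ℕ, ∃ L : ℕ, L₀ ≤ L ∧ coldDefect r.ρ β L ≤ ε := by
  intro ε hε L₀
  set ε' : ℝ := min ε 1 / 8 with hε'def
  have hε'0 : 0 < ε' := by
    rw [hε'def]; have := lt_min hε one_pos; positivity
  have hε'1 : ε' ≤ 1 / 8 := by
    rw [hε'def]; have := min_le_right ε 1; linarith
  have hε'ε : 4 * ε' ≤ ε := by
    rw [hε'def]; have := min_le_left ε 1; linarith
  obtain ⟨L₁, hL₁⟩ := hF ε' hε'0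
  obtain ⟨L, hL, s, h1, -, hcen, hVL⟩ := hV ε' hε'0 (max L₀ L₁)
  refine ⟨L, le_trans (le_max_left _ _) hL, ?_⟩
  have hFL : ∀ z ∈ s, ∀ t : ℕ, (t = L / 4 ∨ t = 2 * (L / 4)) →
      |twistedColdZ r.ρ β z L t - wilsonFinTorusPartition r.ρ β L L L t| ≤
        ε' * wilsonFinTorusPartition r.ρ β L L L t :=
    fun z hz t ht => hL₁ L (le_trans (le_max_right _ _) hL) z (hcen z hz) t ht
  exact le_trans (coldDefect_le_of_flux_vac r β L hε'0.le hε'1 s h1 hFL hVL) hε'ε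

end Rungs

/-- **RUNG for F, TYPED-OPEN (no sorry; the line's first prover target if KEYed): confined temporal twist on the
strong-coupling window, EVERY compact `G`** — Münster's strong-coupling vortex free-energy area law in cold-box form.
Plan: `PlaqSystem` polymer expansion of the tree (InfiniteVolumeSufficientXV) for the twisted cost; a polymer not wrapping the
twisted `(μ,3)` 2-torus has twist-independent activity (central twist = coboundary there); wrapping polymers have ≥ `L·⌊L/4⌋`
plaquettes ⇒ `|log Z^{(z)} − log Z| ≤ 3·L²·(C·β)^{L⌊L/4⌋} → 0`.  TRUE for `U(1)` as well — F's abelian failure is at WEAK coupling.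
[Munster1981] [cite: G. Münster, Nucl. Phys. B180 (1981) 23, §3] -/
def ConfinedTemporalTwistStrongCoupling : Prop :=
  ∀ (G : Type) [Group G] [TopologicalSpace G] [IsTopologicalGroup G] [CompactSpace G],
    letI : MeasurableSpace G := borel G
    haveI : BorelSpace G := ⟨rfl⟩
    ∀ r : LatticeRep G, ∀ β : ℝ, 0 ≤ β → β ≤ strongCouplingRadius r.ρ → ConfinedTemporalTwistAt r β

/-! ## §5 The tree's twist library and barrier (DEDUP record, critic ym-ir-crit-3 price (iv); rev 2)

`twistedColdZ` is the 4:1-COLD-BOX shadow of the tree's SYMMETRIC-torus twist vocabulary — same stack convention (twist the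
`(μ,ν)`-plaquettes based at `x_μ = 0 ∧ x_ν = 0`), different carrier (`FinTorusSite L L L t`, the carrier of
`wilsonFinTorusPartition`/`coldDefect`/`E`, versus `GaugeConfig d L G` on `(ℤ/Lℤ)^d`).  It is NOT re-based on the tree def because
the cold box needs `t ≠ L`; the asymmetric generalisation is the Literature file's own printed TODO.  By name:
* `Literature.MathematicalPhysics.QuantumFieldTheory.twistedPartitionFunction ρ β L z q` ('t Hooft 1979 / Greensite (4.43)–(4.44));
* `twistedPartitionFunction_le_untwisted_plane` (Kanazawa / RP: `Z(z) ≤ Z(1)` for central `z`, even `L`) — the UPPER half of `F` in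
  the symmetric geometry (so `F` is really the one-sided statement `Z − Z^{(z)} ≤ εZ` plus RP);
* `CentralTwist.one_sub_twistedPartitionFunction_div_le_of_central` (Ito–Seiler 2008 Thm 2.2 (1), PROVED: strong-coupling AREA law
  `1 − Z(z)/Z(1) ≤ 2d²L^{d−2}e^{−L²/2}` on symmetric tori, `|β| ≤ β₁(d,N)`; its printed TODO «asymmetric tori» is exactly this line's
  TYPED-OPEN rung `ConfinedTemporalTwistStrongCoupling`);
* `TomboulisConfinementClaim` (the all-`β` MK-comparison claim) and the barrier
  `Literature.Barriers.QuantumFields.MigdalKadanoffGroupBlindness` (Ito 1985 / Ito–Seiler 2007–09: MK comparison "confines" `U(1)₄`):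
  `F` sits ON this barrier — any proof of `F` by MK comparison fails the `U(1)` test; the line does not evade it, it names it;
* cell: idea-7's `Cruxes/IR/Lines/ym_ir7_tension_ratio_flux.lean` posits `ElectricFluxFloor` — floor-conditioned (`LowerBounds →`), in
  UNITS with a rate `e^{−σ₀a(β)²L²}`, symmetric tori `L = 2^{n+1}`: a STRONGER per-`β` currency than `F` (which is unit-free, unconditioned,
  cold-box, tolerance-only); no kernel implication either way because of the geometry. -/

/-- DEDUP anchor (kernel-visible): the tree's strong-coupling vortex bound this line's F-rung must generalise to `L³ × t`. -/
example := @CentralTwist.one_sub_twistedPartitionFunction_div_le_of_central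

/-- DEDUP anchor: the tree's RP upper bound `Z(z) ≤ Z(1)` (symmetric torus, even `L`). -/
example := @twistedPartitionFunction_le_untwisted_plane

/-- DEDUP anchor: the catalogued barrier `F` sits on. -/
example : Prop := Literature.Barriers.QuantumFields.MigdalKadanoffGroupBlindness

/-! ## §3 Stubs of THIS line (crux-write only — NOT registered, RULING g9-№1) and the composition BY NAME -/

/-- stub F (NEW, this line): confined temporal twist in cold 4:1 boxes.  U(1)-probe: FALSE (light electric flux). -/
theorem stub_confinedTemporalTwist : ConfinedTemporalTwistSC := by
  sorry

/-- stub V (NEW as a cut; content = E in the flux-free sector): U(1)-probe: FALSE (photon); SO(3)-probe: FALSE (flux vacua). -/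
theorem stub_vacuumSectorPurity : VacuumSectorPuritySC := by
  sorry

/-- stub X (the pincer's ∕ line 10's, shared — NOT new). -/
theorem stub_afToColdPressure : AFToColdPressure := by
  sorry

/-- stub N (residual, shared — NOT new). -/
theorem stub_irnsc : IRnsc := by
  sorry

/-- **E from the cut** (over the two new stubs; seam PROVED). -/
theorem coldExitSC_of_stubs : ColdExitSC :=
  coldExitSC_of_split stub_confinedTemporalTwist stub_vacuumSectorPurity

/-- **The composition BY NAME: `F ∧ V ∧ X ∧ N ⇒ IR`** through line 10's `IR_of_bridge` with `R := coldDoublingRecursionSC_holds`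
(tree, p596893) and `E := coldExitSC_of_split F V`. -/
theorem IR_of_stubs : Summit.QuantumFields.YangMills.Theses.BalabanLadder.IR :=
  IR_of_bridge coldDoublingRecursionSC_holds coldExitSC_of_stubs stub_afToColdPressure stub_irnsc

/-- Hypothesis form of the same composition (for readers: exactly which Props carry the leaf on this line). -/
theorem IR_of_split (hF : ConfinedTemporalTwistSC) (hV : VacuumSectorPuritySC) (hX : AFToColdPressure) (hN : IRnsc) :
    Summit.QuantumFields.YangMills.Theses.BalabanLadder.IR :=
  IR_of_bridge coldDoublingRecursionSC_holds (coldExitSC_of_split hF hV) hX hN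

end Summit.QuantumFields.YangMills.Cruxes.IR.FluxPuritySplit

end
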